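import Literature.AlgebraicGeometry.Resolution.ArithmeticalThreefoldsLocal
import Literature.AlgebraicGeometry.Resolution.LocalBlowup
import Literature.RingTheory.HilbertSamuel.Multiplicity
import Mathlib.RingTheory.Ideal.Height
import Mathlib.RingTheory.Ideal.Cotangent
import Mathlib.RingTheory.Polynomial.Resultant.Basic
import Mathlib.RingTheory.Localization.AtPrime.Basic
import Mathlib.RingTheory.Ideal.Quotient.Operations
import HarnessLib

/-!
# Cossart–Piltant 2019: the local theorem in TOWER form (Thm. 1.5 as printed) and the
# valuation-INDEPENDENT exit from multiplicity `p` (Thm. 2.81 + Thm. 5.5, Def. 2.77)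

Topic: `Literature/AlgebraicGeometry/Resolution`; fifth layer next to `ArithmeticalThreefoldsLocal.lean`
(`CossartPiltant2019Local` = journal Thm. 1.5 in WEAK local-uniformization form). Source (published,
refereed): V. Cossart, O. Piltant, *Resolution of singularities of arithmetical threefolds*, J. Algebra
**529** (2019) 268–535 [CossartPiltant2019], read in the held JOURNAL text
(`paper:cossart2019-resolution-singularities-arithmetical-threefolds`; locators `pNNNN Lkk` below are pages /
lines of that text; concordance with arXiv:1412.0868v1: journal Thm. 1.5 = v1 Thm. 1.4, Def. 2.77 = v1
Def. 2.18, Thm. 5.5 = v1 Thm. 5.1, Cor. 5.6 = v1 Cor. 5.2, Cor. 4.19 = v1 Cor. 4.13).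

What the weak form `CossartPiltant2019Local` does not vendor is (α) the SHAPE of the printed conclusion
— a finite composition of LOCAL HIRONAKA-PERMISSIBLE BLOWING UPS along the valuation (Def. 2.20:
"Let `𝒴 ⊂ 𝒳` be an integral closed subscheme with generic point `y`. We say that `𝒴` is
Hironaka-permissible at `x ∈ 𝒴` if `m(y) = m(x)` and `𝒴` is regular at `x`", p0026 L37–39; "By a local
Hironaka-permissible blowing up, we simply mean the localization at some point of the exceptional divisor
`π⁻¹(𝒴)` of the blowing up `π` along a Hironaka-permissible center", p0027 L12–14) — and (β) the
INDEPENDENCE of the centres from the valuation (Def. 2.77, p0067 L45–p0068 L4: "Suppose that to every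
valuation `μ` of `L` centered at `x`, a composition of local Hironaka-permissible blowing ups (2.87) is
associated, where `xᵢ ∈ 𝒳ᵢ` is the center of `μ`. The sequence (2.87) is said to be independent if the
blowing up center `𝒴ᵢ ⊂ (𝒳ᵢ, xᵢ)` does not depend on the chosen valuation `μ` having center `xᵢ` in
`𝒳ᵢ`"), which the paper proves in the multiplicity-`p` regime: Thm. 2.81 (p0074 L5–7: "Assume that
`(m(x), ω(x)) = (p, 0)`, where `{x} = η⁻¹(m_S)`. For every valuation `μ` of `L = Tot(S[X]/(h))` centered
at `x`, there exists a finite and independent composition of local Hironaka-permissible blowing ups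
(2.87) such that `m(x_r) < p`") and the Projection Theorem 5.5 (p0138 L8–12: "Assume that `(S, h, E)`
satisfies assumption (G) and (E), with `m(x) = p` and `ω(x) > 0`. For every valuation `μ` of
`L = k(𝒳)` centered at `x`, there exists a finite and independent composition of local
Hironaka-permissible blowing ups (5.3) such that `ι(x_r) < ι(x)`, i.e. `x` is good."), from which Cor. 5.6
(p0138 L13–17) derives Thms. 1.1 and 1.5.

## Content (namespace `Literature.AlgebraicGeometry.Resolution`)

* `CossartPiltant2019.IsHironakaPermissibleAt R P` — Def. 2.20 in RING form for the germ `Spec R`,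
  `R = 𝒪_{𝒳ᵢ,xᵢ}`, and a centre `V(P)`: `P` is prime and at EVERY point `Q ⊇ P` of the centre, `V(P)` is
  regular (`R_Q ⧸ P R_Q` is a regular local ring) and equimultiple (`e(R_Q) = e(R_P)`), the multiplicity
  being the tree's Samuel multiplicity `Literature.RingTheory.HilbertSamuel.samuelMultiplicity`
  (RENDERING, see Faithfulness (2)). (The bare name `IsHironakaPermissible` is taken by the CJS-chart form
  of `CentreBlowupAdaptedOrder.lean`; the two are not related by any theorem here.)
* `CossartPiltant2019.ConditionE p S h x u` — assumption (E) of Def. 2.32 (p0033 L16–23: "`(S, h, E)`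
  satisfies assumption (E) if `char(S/m_S) = p > 0` and one of the following properties holds:
  (i) `D = 0` and `η(Sing_p 𝒳) ⊆ E`, (ii) `D ≠ 0` and `div(D)_red ⊆ E ⊆ div(p)_red`", `D := Disc_X h`,
  `E = div(u₁ ⋯ u_e)` for a regular system of parameters `(u₁, …, u_n)` of `S` adapted to `E`,
  Def. 2.19 p0026 L33–35), rendered on `S[x] ⊆ L` (see Faithfulness (3)).
* `CossartPiltant2019_thm_1_5` — NAMED FACT (F-99a): journal Thm. 1.5 (p0004 L37–p0005 L9) AS PRINTED,
  in TOWER form: for every valuation ring `O` of `L` dominating `S` there is a finite tower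
  `𝒪_{𝒳,x₀} = R₀ → R₁ → ⋯ → R_n` of local blowing ups with respect to `O`
  (`IsLocalBlowupAlong O`, `LocalBlowup.lean`) along Hironaka-permissible centres `Pᵢ ⊂ Rᵢ`, with `R_n`
  a regular local ring.  No independence is asserted (Thm. 1.5 does not print it).  The PROVED edge
  `CossartPiltant2019Local_of_thm_1_5 : CossartPiltant2019_thm_1_5 → CossartPiltant2019Local` is the
  sibling kernel file `ArithmeticalThreefoldsLocalIndependentLinks.lean` (this file is statement-only).
* `CossartPiltant2019_exitMultiplicityP_independent` — NAMED FACT (F-99b, COMPOSITE): under (G) and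
  (E), a valuation-free CENTRE RULE exists whose directed run of local Hironaka-permissible blowing ups
  reaches, for EVERY valuation ring `O` of `L` dominating `S`, a local ring of multiplicity `< p` after
  finitely many steps (for `p = 2`: a regular local ring).  Derivation chain, one READ locator per link:
  (ℓ1) Def. 2.77 p0067 L45–p0068 L4 (independent := `𝒴ᵢ` depends only on `(𝒳ᵢ, xᵢ)`; `(𝒳ᵢ, xᵢ)` is
  determined by `(𝒳, x₀)`, the previous centres and the centre `xᵢ` of `μ` — hence "a rule reading the
  HISTORY `(R₀, P₀, …, R_{i-1}, P_{i-1})` and the current local ring `Rᵢ`"; a rule reading `Rᵢ` alone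
  would be MORE than print and is not asserted); (ℓ2) Thm. 2.81 p0074 L5–7 (`ω(x) = 0`: independent
  exit `m(x_r) < p`); (ℓ3) Thm. 5.5 p0138 L8–12 (`ω(x) > 0`: independent drop `ι(x_r) < ι(x)`; the
  sequences (5.3) preserve (G) and (E), p0137 L22–27); (ℓ4) `ι = (m, ω, κ)` takes values in a well-ordered
  set (eq. (1.4) p0005 L35) and "Theorem 1.5 follows easily by induction on `ι(x)` (Corollary 5.6)"
  (p0007 L15–16; Cor. 5.6 proof p0138 L13–17) — restricted to the stages with `m(xᵢ) = p` this induction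
  uses only (ℓ2), (ℓ3); (ℓ5) concatenation along an independent sequence: Remark 5.7 p0138 L18–25 ("`x` is
  resolved for `(p, ω(x), a)` if for every `μ`, there exists some `r = r(μ) ≥ 0` such that `x_r` is
  resolved"); (ℓ6) if `m(x₀) < p` already there is nothing to do (`n = 0`); if `m(x₀) = p` then
  `{x₀} = η⁻¹(m_S)` (Prop. 2.10) and (ℓ2)–(ℓ5) apply.  Standing hypotheses: `S` excellent regular local
  of dimension `n = 3` (§5, p0135 L36–38), `char(S/m_S) = p`, (G) p0029 L37–38 with cases (a)(b)(c)
  p0030 L1–3 (for irreducible `h`: (b) = Thm. 1.5 (ii), (c) = Thm. 1.5 (i)), (E) Def. 2.32.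
* `CossartPiltant2019_exitMultiplicityP_independent'` — NAMED FACT (F-99b′, rev 2 append): the same, with the
  printed meaning of the exit value recorded — "`𝒪_{𝒳,y}` is a regular local ring `⇔ m(y) = 1`" (p0015 L6)
  at the last stage (Prop. 2.22 p0027 L16–22 keeps every `(𝒳ᵢ, xᵢ)` a hypersurface germ `Spec Sᵢ[X]/(hᵢ)`),
  i.e. the extra clause `e(R_n) ≤ 1 → R_n regular`; for `p = 2` the run ends at a REGULAR point (the reading the
  `W₃⁽²'²⁾` consumer of chain w43 needs).  It implies F-99b by dropping the clause (kernel edge in the Links file).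

## Faithfulness notes (both facts are WEAKER than or EQUIVALENT READINGS of print; nothing is wider)

(1) As in `CossartPiltant2019Local`: the case `h` IRREDUCIBLE of the printed "`h` reduced,
`L = Tot(S[X]/(h))`" (then `L = K(x)` is a field and `S[X]/(h) = S[x] ⊆ L`), `S` a domain (true for
regular local rings), and "`μ` a valuation of `L` centered in `m_S`" = a valuation subring `O ∋ S` of `L`
with `v(s) < 1` on `m_S`; the centre `x₀` of `μ` on `𝒳` is then the prime `𝔪_O ∩ S[x]` (`x ∈ O`, being
integral over `S ⊆ O`), and `𝒪_{𝒳,x₀} = locAtCentre S[x] O` (`LocalBlowup.lean`).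
(2) MULTIPLICITY. The paper's `m(y) := ord_{m_{S[X]_y}} h` (p0015 L1–6; "Hironaka-permissible centers
are classically defined as regular subschemes along which a given Noetherian scheme is normally flat.
Since we are dealing with hypersurface singularities, the latter condition can be stated in terms of the
multiplicity function `m`", p0026 L27–30) is RENDERED by the Samuel multiplicity `e(𝒪_{𝒳,y})` of the
local ring (Matsumura §14; for a hypersurface `A/(f)` in a regular local ring `A`, `e(A/(f)) = ord_A f`) —
an equivalent reading for the local rings occurring here (localisations of `S'[X']/(h')`, Prop. 2.22
p0027 L15–22), intrinsic to the subrings `Rᵢ ⊆ L`, flagged as a rendering and not proved here.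
(3) CONDITION (E). "`(u₁, …, u_e)` extends to a regular system of parameters of `S`" is rendered by
linear independence of the classes of the `u_j ∈ m_S` in the cotangent space `m_S/m_S²` (Matsumura
Thm. 14.2); `D` by Mathlib's `Polynomial.discr h` (the discriminant up to sign — only `D = 0` and the
prime divisors of `D` enter); `η(y) ∈ E = V(u₁ ⋯ u_e)` for `y ↔ 𝔮 ⊂ S[x]` by `∃ j, u_j ∈ 𝔮`;
`div(D)_red ⊆ E` by "every height-one prime of `S` containing `D` contains some `u_j`" (then it IS
`(u_j)`, `S` being a UFD); `E ⊆ div(p)_red` by `u_j ∣ p`; `Sing_p 𝒳 = {y : m(y) = p}` (p0015 L10) via (2).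
(4) LOCAL BLOWING UPS. A local Hironaka-permissible blowing up of `(𝒳ᵢ, xᵢ)` at the centre `x_{i+1}` of
`μ` is the step `IsLocalBlowupAlong O Rᵢ Pᵢ R_{i+1}` of `LocalBlowup.lean` (the chart of `Bl_{Pᵢ} Spec Rᵢ`
of a generator of minimal value, localised at the centre of `O`), `Pᵢ` Hironaka-permissible at every
point of `V(Pᵢ) ⊆ Spec Rᵢ` (the points of the centre that the germ sees).
(5) NOT VENDORED: independence in the regime `m(x) < p` (Cor. 5.6 takes it from [31] = Cossart–Piltant,
RACSAM 108 (2014), whose Main Theorem prints no independence) — hence no "independent all the way to a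
regular point" statement; permissibility WITH RESPECT TO `E` (Def. 2.21: normal crossings with `E`) of the
centres, which the proofs of Thms. 2.81/5.5 provide but their statements (via (2.87)/(5.3), Def. 2.20) do
not print; the invariants `ω, κ, ι` themselves.

**Caveat: AI-typed statement of a refereed theorem; weaker than expert review; nothing here is a claim
about any manuscript under adjudication.**

## Sources

* V. Cossart, O. Piltant, J. Algebra 529 (2019) 268–535: Thm. 1.5 (p0004 L37–p0005 L9), §2.1 `m(y)`,
  `Sing_m` (p0015 L1–10), Defs. 2.19–2.21 (p0026 L33–p0027 L5), local Hironaka-permissible blowing up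
  (p0027 L12–14), Prop. 2.22 (p0027 L15–22), (G) (p0029 L37–p0030 L3), Def. 2.32 (E) (p0033 L16–25),
  Def. 2.77 (p0067 L45–p0068 L4), Thm. 2.81 (p0074 L5–7), (5.3) (p0137 L22–34), Thm. 5.5, Cor. 5.6,
  Remark 5.7 (p0138 L1–25), Cor. 4.19 (p0135 L11–21). [CossartPiltant2019]
* H. Matsumura, *Commutative Ring Theory*, §14 (multiplicity; Thm. 14.2). [Matsumura1987]
* J. Novacoski, M. Spivakovsky, arXiv:1204.4751, Defs. 2.8/2.11 (local blowing ups; `LocalBlowup.lean`).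
  [NovacoskiSpivakovsky2014]
-/

noncomputable section

open IsLocalRing Polynomial
open Literature.RingTheory.HilbertSamuel

namespace Literature.AlgebraicGeometry.Resolution

universe u

namespace CossartPiltant2019

/-- **Hironaka-permissible centre of a germ, ring form** (Cossart–Piltant Def. 2.20: "Let `𝒴 ⊂ 𝒳` be an
integral closed subscheme with generic point `y`. We say that `𝒴` is Hironaka-permissible at `x ∈ 𝒴` if
`m(y) = m(x)` and `𝒴` is regular at `x`"; a Hironaka-permissible blowing up is one "along a center
`𝒴 ⊂ 𝒳` which is Hironaka-permissible at each point of its support").  For the local ring `R` of the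
germ `(𝒳ᵢ, xᵢ)` and the ideal `P` of the centre: `P` is prime (the centre is integral) and at EVERY point
`Q ⊇ P` of `V(P) ⊆ Spec R` the centre is regular — `R_Q ⧸ P R_Q ≅ (R/P)_Q` is a regular local ring — and
`𝒳` is equimultiple along it — `e(R_Q) = e(R_P)`, `e` the Samuel multiplicity of a local ring (RENDERING of
the printed `m = ord`, module docstring, Faithfulness (2)).
[cite: CossartPiltant2019, Def. 2.20 (J. Algebra 529, p. 293) and §2.2 (local Hironaka-permissible blowing up, p. 294)] -/
def IsHironakaPermissibleAt (R : Type u) [CommRing R] (P : Ideal R) : Prop :=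
  ∃ (_ : P.IsPrime), ∀ (Q : Ideal R) [Q.IsPrime], P ≤ Q →
    IsRegularLocalRing (Localization.AtPrime Q ⧸ P.map (algebraMap R (Localization.AtPrime Q))) ∧
      samuelMultiplicity (Localization.AtPrime Q) = samuelMultiplicity (Localization.AtPrime P)

/-- **Assumption (E) of Cossart–Piltant Def. 2.32**, for `(S, h, E)` with `E = div(u₁ ⋯ u_e)`, rendered
on `S[x] ⊆ L` (`x` a root of the monic `h`, `S[X]/(h) = S[x]` for `h` irreducible): "`(S, h, E)` satisfies
assumption (E) if `char(S/m_S) = p > 0` and one of the following properties holds: (i) `D = 0` and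
`η(Sing_p 𝒳) ⊆ E`, (ii) `D ≠ 0` and `div(D)_red ⊆ E ⊆ div(p)_red`" (`D := Disc_X(h)`; Def. 2.19: the
family `(u₁, …, u_e)` extends to a regular system of parameters of `S`).  Readings (module docstring,
Faithfulness (3)): the `u_j` lie in `m_S` with linearly independent classes in `m_S/m_S²`; `D` is Mathlib's
`Polynomial.discr h`; `η(Sing_p 𝒳) ⊆ E` says that every prime `𝔮` of `S[x]` of multiplicity
`e(S[x]_𝔮) = p` contains some `u_j`; `div(D)_red ⊆ E` says that every height-one prime of `S` containing
`D` contains some `u_j`; `E ⊆ div(p)_red` says `u_j ∣ p` for all `j`.  The clause `char(S/m_S) = p` is the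
first conjunct. [cite: CossartPiltant2019, Def. 2.32 and Def. 2.19 (J. Algebra 529, pp. 300 and 293)] -/
def ConditionE (p : ℕ) (S : Type u) [CommRing S] [IsLocalRing S] {L : Type u} [Field L] [Algebra S L]
    (h : S[X]) (x : L) {e : ℕ} (u : Fin e → S) : Prop :=
  CharP (ResidueField S) p ∧
  (∃ hu : ∀ j, u j ∈ maximalIdeal S,
      LinearIndependent (ResidueField S) fun j => (maximalIdeal S).toCotangent ⟨u j, hu j⟩) ∧
  ((h.discr = 0 ∧
      ∀ (𝔮 : Ideal (Algebra.adjoin S ({x} : Set L))) [𝔮.IsPrime],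
        samuelMultiplicity (Localization.AtPrime 𝔮) = p →
          ∃ j, algebraMap S (Algebra.adjoin S ({x} : Set L)) (u j) ∈ 𝔮) ∨
    (h.discr ≠ 0 ∧
      (∀ (𝔭 : Ideal S) [𝔭.IsPrime], 𝔭.height = 1 → h.discr ∈ 𝔭 → ∃ j, u j ∈ 𝔭) ∧
      ∀ j, u j ∣ (p : S)))

end CossartPiltant2019

/-! ## Journal Thm. 1.5 in tower form -/

/-- NAMED FACT (F-99a) — **Cossart–Piltant 2019, journal Thm. 1.5 (arXiv v1 Thm. 1.4) AS PRINTED, tower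
form, case `h` irreducible.** "Let `(S, m_S, k)` be an excellent regular local ring of dimension `n = 3`,
quotient field `K := QF(S)` and residue characteristic `char k = p > 0`. Let
`h := X^p + f₁X^{p-1} + ⋯ + f_p ∈ S[X]` … be a reduced polynomial, `𝒳 := Spec(S[X]/(h))` and
`L := Tot(S[X]/(h))` … Assume that `h` satisfies one of the following assumptions: (i) `char K = p` and
`f₁ = ⋯ = f_{p-1} = 0`, or (ii) `𝒳` is `G`-invariant, where `G := Aut_K(L) = ℤ/p`. Let `μ` be a valuation
of `L` which is centered in `m_S`. There exists a composition of local Hironaka-permissible blowing ups: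
`(𝒳 =: 𝒳₀, x₀) ← (𝒳₁, x₁) ← ⋯ ← (𝒳_r, x_r)` (1.2), where `xᵢ ∈ 𝒳ᵢ` is the center of `μ`, such that
`(𝒳_r, x_r)` is regular."  Rendering (hypotheses exactly those of `CossartPiltant2019Local`): for every
valuation subring `O` of `L` containing `S` and centered in `m_S` there are `n : ℕ`, subrings
`R₀, …, R_n ⊆ L` and centres `Pᵢ ⊂ Rᵢ` with `R₀ = 𝒪_{𝒳,x₀} = (S[x])_{𝔪_O ∩ S[x]}` (`locAtCentre`), each
`R_{i+1}` the local blowing up of `Rᵢ` along `Pᵢ` with respect to `O` (`IsLocalBlowupAlong`), each `Pᵢ`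
Hironaka-permissible (`CossartPiltant2019.IsHironakaPermissibleAt`), and `R_n` a regular local ring.
Independence of the centres from `μ` is NOT asserted here (see
`CossartPiltant2019_exitMultiplicityP_independent`).  Users take `(h : CossartPiltant2019_thm_1_5)`; it
implies the weak form (`CossartPiltant2019Local_of_thm_1_5`, sibling file `…LocalIndependentLinks.lean`).
[cite: CossartPiltant2019, Thm. 1.5 (J. Algebra 529, pp. 271–272; arXiv v1: Thm. 1.4) and Def. 2.20] -/
def CossartPiltant2019_thm_1_5 : Prop :=
  ∀ (p : ℕ), p.Prime →
  ∀ (S : Type u) [CommRing S] [IsDomain S] [IsRegularLocalRing S],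
    IsExcellentRing S → ringKrullDim S = 3 → CharP (ResidueField S) p →
  ∀ (K : Type u) [Field K] [Algebra S K] [IsFractionRing S K]
    (L : Type u) [Field L] [Algebra K L] [Algebra S L] [IsScalarTower S K L]
    (h : S[X]) (x : L),
    h.Monic → h.natDegree = p → Irreducible (h.map (algebraMap S K)) → aeval x h = 0 →
    Algebra.adjoin K ({x} : Set L) = ⊤ →
    ((CharP K p ∧ ∀ i, 0 < i → i < p → h.coeff i = 0) ∨
      (Nat.card (L ≃ₐ[K] L) = p ∧
        ∀ σ : L ≃ₐ[K] L, ∀ y ∈ Algebra.adjoin S ({x} : Set L),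
          σ y ∈ Algebra.adjoin S ({x} : Set L))) →
  ∀ (O : ValuationSubring L), (∀ s : S, algebraMap S L s ∈ O) →
    (∀ s ∈ maximalIdeal S, O.valuation (algebraMap S L s) < 1) →
    ∃ (n : ℕ) (R : ℕ → Subring L) (P : ∀ i, Ideal (R i)),
      R 0 = locAtCentre (Algebra.adjoin S ({x} : Set L)).toSubring O ∧
      (∀ i < n, CossartPiltant2019.IsHironakaPermissibleAt (R i) (P i) ∧
        IsLocalBlowupAlong O (R i) (P i) (R (i + 1))) ∧
      IsRegularLocalRing (R n)

/-! ## The independent exit from multiplicity `p` -/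

/-- NAMED FACT (F-99b, COMPOSITE) — **Cossart–Piltant 2019, Thm. 2.81 + Projection Theorem 5.5 (arXiv v1
Thm. 5.1) with Def. 2.77 (v1 Def. 2.18): the valuation-INDEPENDENT exit from multiplicity `p`, case `h`
irreducible.**  Under the hypotheses of Thm. 1.5 and assumption (E) of Def. 2.32 for `(S, h, E)`,
`E = div(u₁ ⋯ u_e)`: there is a CENTRE RULE `centre`, assigning to a history
`(R₀, P₀), …, (R_{i-1}, P_{i-1})` of local rings and centres and a current local ring `Rᵢ ⊆ L` an ideal
of `Rᵢ` — and NOT reading the valuation —, such that for EVERY valuation subring `O` of `L` containing `S`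
and centered in `m_S` the `O`-directed run `R₀ = 𝒪_{𝒳,x₀}` (`x₀` the centre of `O` on `𝒳 = Spec S[x]`),
`Pᵢ = centre(history, Rᵢ)`, `R_{i+1} =` the local blowing up of `Rᵢ` along `Pᵢ` with respect to `O`,
consists of Hironaka-permissible centres and reaches after finitely many steps a local ring `R_n` of
multiplicity `e(R_n) < p` ("`m(x_n) < p`"; for `p = 2`, a regular local ring).  Printed sources:
Thm. 2.81 "Assume that `(m(x), ω(x)) = (p, 0)`, where `{x} = η⁻¹(m_S)`. For every valuation `μ` of
`L = Tot(S[X]/(h))` centered at `x`, there exists a finite and independent composition of local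
Hironaka-permissible blowing ups (2.87) such that `m(x_r) < p`."; Thm. 5.5 "Assume that `(S, h, E)`
satisfies assumption (G) and (E), with `m(x) = p` and `ω(x) > 0`. For every valuation `μ` of `L = k(𝒳)`
centered at `x`, there exists a finite and independent composition of local Hironaka-permissible blowing
ups (5.3) such that `ι(x_r) < ι(x)`, i.e. `x` is good."; Def. 2.77 "The sequence (2.87) is said to be
independent if the blowing up center `𝒴ᵢ ⊂ (𝒳ᵢ, xᵢ)` does not depend on the chosen valuation `μ` having
center `xᵢ` in `𝒳ᵢ`"; combined by the induction on `ι` of Cor. 5.6 and the concatenation Remark 5.7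
(derivation chain (ℓ1)–(ℓ6) in the module docstring; COMPOSITE, one routine step per link).  NOT
asserted: independence below multiplicity `p`, permissibility with respect to `E`.  Users take
`(h : CossartPiltant2019_exitMultiplicityP_independent)`.
[cite: CossartPiltant2019, Thm. 2.81, Thm. 5.5, Cor. 5.6, Rem. 5.7, Def. 2.77, Def. 2.32 (J. Algebra 529, pp. 341, 405, 334–335, 300; arXiv v1: Thm. 5.1, Cor. 5.2, Def. 2.18)] -/
def CossartPiltant2019_exitMultiplicityP_independent : Prop :=
  ∀ (p : ℕ), p.Prime →
  ∀ (S : Type u) [CommRing S] [IsDomain S] [IsRegularLocalRing S],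
    IsExcellentRing S → ringKrullDim S = 3 → CharP (ResidueField S) p →
  ∀ (K : Type u) [Field K] [Algebra S K] [IsFractionRing S K]
    (L : Type u) [Field L] [Algebra K L] [Algebra S L] [IsScalarTower S K L]
    (h : S[X]) (x : L),
    h.Monic → h.natDegree = p → Irreducible (h.map (algebraMap S K)) → aeval x h = 0 →
    Algebra.adjoin K ({x} : Set L) = ⊤ →
    ((CharP K p ∧ ∀ i, 0 < i → i < p → h.coeff i = 0) ∨
      (Nat.card (L ≃ₐ[K] L) = p ∧
        ∀ σ : L ≃ₐ[K] L, ∀ y ∈ Algebra.adjoin S ({x} : Set L),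
          σ y ∈ Algebra.adjoin S ({x} : Set L))) →
  ∀ (e : ℕ) (u : Fin e → S), CossartPiltant2019.ConditionE p S h x u →
  ∃ centre : List ((B : Subring L) × Ideal B) → (B : Subring L) → Ideal B,
    ∀ (O : ValuationSubring L), (∀ s : S, algebraMap S L s ∈ O) →
      (∀ s ∈ maximalIdeal S, O.valuation (algebraMap S L s) < 1) →
      ∃ (n : ℕ) (R : ℕ → Subring L) (P : ∀ i, Ideal (R i)),
        R 0 = locAtCentre (Algebra.adjoin S ({x} : Set L)).toSubring O ∧
        (∀ i < n, P i = centre ((List.range i).map fun j => ⟨R j, P j⟩) (R i) ∧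
          CossartPiltant2019.IsHironakaPermissibleAt (R i) (P i) ∧
          IsLocalBlowupAlong O (R i) (P i) (R (i + 1))) ∧
        ∃ (_ : IsLocalRing (R n)), samuelMultiplicity (R n) < p

/-- NAMED FACT (F-99b′, COMPOSITE; same sources as `CossartPiltant2019_exitMultiplicityP_independent` plus
§2.1 p0015 L6 and Prop. 2.22) — **the same independent exit from multiplicity `p`, with the printed meaning
of the exit value recorded: `m(x_n) < p` AND "`𝒪_{𝒳,y}` is a regular local ring `⇔ m(y) = 1`".**  The paper's
`m(y) := ord_{m_{S[X]_y}} h ≥ 1` (p0015 L1–6) satisfies "By definition of regular local rings, we thus have: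
`𝒪_{𝒳,y}` is a regular local ring `⇔ m(y) = 1`" (p0015 L6), at every stage of the sequence since each
`(𝒳ᵢ, xᵢ)` is again locally `Spec(Sᵢ[X]/(hᵢ))` with `Sᵢ` regular local and `hᵢ` monic (Prop. 2.22,
p0027 L16–22: "there exists `h' ∈ S'[X']` monic of degree `m` such that `𝒳'_{s'} = Spec(S'[X']/(h'))`").
Hence the exit `m(x_n) < p` of Thm. 2.81 / Cor. 5.6 carries: if `m(x_n) ≤ 1` then `(𝒳_n, x_n)` is REGULAR —
in particular for `p = 2` the independent run ENDS AT A REGULAR POINT.  With `m` rendered by the Samuel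
multiplicity `e` (Faithfulness (2) of the module docstring) this is the extra clause
`samuelMultiplicity (R n) ≤ 1 → IsRegularLocalRing (R n)` below; everything else is
`CossartPiltant2019_exitMultiplicityP_independent` VERBATIM (which it implies by dropping the clause; kernel
edge in the sibling Links file).  Users take `(h : CossartPiltant2019_exitMultiplicityP_independent')`.
[cite: CossartPiltant2019, Thm. 2.81, Thm. 5.5, Cor. 5.6, Rem. 5.7, Def. 2.77, Def. 2.32, §2.1 (m(y) = 1 iff regular) and Prop. 2.22 (J. Algebra 529, pp. 341, 405, 334–335, 300, 282, 294; arXiv v1: Thm. 5.1, Cor. 5.2, Def. 2.18)] -/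
def CossartPiltant2019_exitMultiplicityP_independent' : Prop :=
  ∀ (p : ℕ), p.Prime →
  ∀ (S : Type u) [CommRing S] [IsDomain S] [IsRegularLocalRing S],
    IsExcellentRing S → ringKrullDim S = 3 → CharP (ResidueField S) p →
  ∀ (K : Type u) [Field K] [Algebra S K] [IsFractionRing S K]
    (L : Type u) [Field L] [Algebra K L] [Algebra S L] [IsScalarTower S K L]
    (h : S[X]) (x : L),
    h.Monic → h.natDegree = p → Irreducible (h.map (algebraMap S K)) → aeval x h = 0 →
    Algebra.adjoin K ({x} : Set L) = ⊤ →
    ((CharP K p ∧ ∀ i, 0 < i → i < p → h.coeff i = 0) ∨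
      (Nat.card (L ≃ₐ[K] L) = p ∧
        ∀ σ : L ≃ₐ[K] L, ∀ y ∈ Algebra.adjoin S ({x} : Set L),
          σ y ∈ Algebra.adjoin S ({x} : Set L))) →
  ∀ (e : ℕ) (u : Fin e → S), CossartPiltant2019.ConditionE p S h x u →
  ∃ centre : List ((B : Subring L) × Ideal B) → (B : Subring L) → Ideal B,
    ∀ (O : ValuationSubring L), (∀ s : S, algebraMap S L s ∈ O) →
      (∀ s ∈ maximalIdeal S, O.valuation (algebraMap S L s) < 1) →
      ∃ (n : ℕ) (R : ℕ → Subring L) (P : ∀ i, Ideal (R i)),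
        R 0 = locAtCentre (Algebra.adjoin S ({x} : Set L)).toSubring O ∧
        (∀ i < n, P i = centre ((List.range i).map fun j => ⟨R j, P j⟩) (R i) ∧
          CossartPiltant2019.IsHironakaPermissibleAt (R i) (P i) ∧
          IsLocalBlowupAlong O (R i) (P i) (R (i + 1))) ∧
        ∃ (_ : IsLocalRing (R n)), samuelMultiplicity (R n) < p ∧
          (samuelMultiplicity (R n) ≤ 1 → IsRegularLocalRing (R n))

end Literature.AlgebraicGeometry.Resolution

end
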